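import Literature.MathematicalPhysics.QuantumLattice.CanonicalClassGroundStateRows
import Literature.MathematicalPhysics.QuantumLattice.HubbardTTPrimeEnergyDensityVariationalPrinciple
import Literature.MathematicalPhysics.QuantumLattice.PairSourcedTorusLimitResponse
import Literature.MathematicalPhysics.QuantumManyBody.StateRelaxationKKT
import Literature.MathematicalPhysics.QuantumLattice.HubbardFillingBoxChemicalPotentialCell
import Literature.MathematicalPhysics.QuantumLattice.HubbardTTPrimeTorusLimitState
import HarnessLib

/-!
# Torus limits of ASYMPTOTICALLY ground-state families are fixed-density mean-energy minimisers, hence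
# translation-invariant ground states of `H^{tt'} − μN` for a supporting `μ`: ALL ground-state rows
# (stationarity, Bratteli–Robinson / KKT blocks, charged generators included) hold in them

Topic `Literature/MathematicalPhysics/QuantumLattice`; namespace = path. Reader layer on top of
`CanonicalClassGroundStateRows.lean` (a translation-invariant state of density `ρ ∈ (0,2)` minimising the
`t–t'` mean energy among translation-invariant states of density `ρ` is, for SOME chemical potential `μ`, a
mean-energy minimiser and a Bratteli–Robinson ground state of `hubbardTTPrimeMuInteraction t t' U μ`: Ruelle's
Lagrange multiplier × Bratteli–Kishimoto–Robinson 1978 Thm. 2), of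
`HubbardTTPrimeEnergyDensityVariationalPrinciple.lean` (`e(t,t',U,ρ) ≤ e_ω` for every translation-invariant
`ω` of density `ρ`) and of the torus dictionary (`torusAvgExpect_nAt`, `torusAvgExpect_hubbardTTPrime_meanEnergyObs`).

The tree's torus-limit row theorems (`IsTorusLimitOf.localStability`, `…re_expect_kktForm_nonneg`,
`…symmetric_groundState_of_sectorGroundStates`) are stated for families of EXACT sector ground states. The
witness families through which a ONE-POINT pair-amplitude certificate is read as a pair-LRO ceiling
(Koma–Tasaki 1994 §2, Kaplan–Horsch–von der Linden 1989: `Ξ_L = (ψ_L + (Δ+Δ†)ψ_L/a_L)/√2`, or the charge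
towers `(Δ†)^m ψ_L/‖·‖`) are NOT eigenvectors: they are unit vectors of mixed particle number whose energy
exceeds the sector ground energy by `O(1)` and whose fillings are `N_L/2 + O(1)`. This file proves that
this is all one needs. For ANY family of torus vectors `ψ_{L_j}` along `L_j → ∞` with

  (N) `Σ_σ Re⟨ψ, N_σ ψ⟩ / L_j² → n ∈ (0,2)` and (E) `limsup_j Re⟨ψ, H^{tt'}_{L_j} ψ⟩ / L_j² ≤ e(t,t',U,n)`

(`U ≥ 0`), every torus limit `ω` (translation average, `IsTorusLimitOf`) is translation invariant, has
density `n`, mean energy EXACTLY `e(t,t',U,n)`, and minimises the mean energy among translation-invariant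
states of density `n` (`IsTorusLimitOf.canonicalMinimiser_of_asymptoticGroundStates`); consequently
(`…exists_groundState_hubbardTTPrimeMu_of_asymptoticGroundStates`) for some `μ` it is a mean-energy minimiser
AND a ground state of `H^{tt'} − μN`, and (`…groundStateRows_of_asymptoticGroundStates`) with that `μ`
EVERY local `A` — number-changing (Nambu / pair generators) or not, spin-flipping or not — obeys
`Re ω((ΓA)⋆[H^{tt'μ}_{Λ₁}, ΓA]) ≥ 0` and `ω([H^{tt'μ}_{Λ₁}, ΓA]) = 0`; every PSD-weighted KKT block is
nonnegative (`…re_expect_kktForm_pencil_nonneg_of_asymptoticGroundStates`); and for `A` commuting with the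
local particle number the rows hold `μ`-free with `H^{tt'}` (`…kkt_of_commute_number_of_asymptoticGroundStates`).
Normalisation `⟨ψ, ψ⟩ → 1` is forced by the torus limit and is not a hypothesis. §4 (appended): the supporting
`μ` lies in the subdifferential `[μ₋(n), μ₊(n)]` (`chemPotMinusTT'`, `chemPotPlusTT'`) — the bracket a
certified `μ`-cover of the one-point program contains (`IsMeanEnergyMinimiser.chemPot_mem_Icc_of_density`,
`IsTorusLimitOf.exists_groundState_hubbardTTPrimeMu_mem_Icc_of_asymptoticGroundStates`).

HONEST SCOPE. Soundness ("licence") statements for the ground-state row class on torus limits of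
near-ground-state families; `μ` is not computed (it is THE supporting chemical potential of a fixed-density
minimiser — bracketed by data in `CanonicalClassChemicalPotential.lean` §4); no number, no certificate.
Everything is PROVED; no definition, no named fact.

## Mathlib / tree search

REUSED: `exists_isGroundState_hubbardTTPrimeMu_of_canonicalMinimiser`, `canonicalMinimiser_ttPrime_kkt_of_commute_number`
(`CanonicalClassGroundStateRows`); `IsGroundState.re_expect_conj_commutator_nonneg`,
`IsGroundState.expect_commutator_localHamiltonian_eq_zero` (`FermionGroundStatesMinimiseMeanEnergy`);
`energyDensityTT'_le_meanEnergy_of_isTranslationInvariant` (`HubbardTTPrimeEnergyDensityVariationalPrinciple`);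
`torusAvgExpect_nAt` (`PairSourcedTorusLimitResponse`), `torusAvgExpect_hubbardTTPrime_meanEnergyObs`
(`HubbardNNNHoppingTorusLimitCorrelator`); `re_map_kktForm_nonneg` (`StateRelaxationKKT`).
`lean search 'asymptoticGroundState|of_tendsto_number'`: nothing (2026-08-27).

## References

* O. Bratteli, A. Kishimoto, D. W. Robinson, *Ground states of quantum spin systems*, Commun. Math. Phys.
  64 (1978) 41–48, Thm. 2 (translation-invariant ground states = mean-energy minimisers).
  [cite: BratteliKishimotoRobinson1978, Thm. 2 (p. 47)]
* T. Koma, H. Tasaki, *Symmetry breaking and finite-size effects in quantum many-body systems*, J. Stat.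
  Phys. 76 (1994) 745–803, §2.2 (low-lying states and their infinite-volume limits).
  [cite: KomaTasaki1994, §2.2]
* D. Ruelle, *Statistical Mechanics: Rigorous Results* (1969), §3.4 (states of given density).
  [cite: Ruelle1969, §3.4]
* O. Bratteli, D. W. Robinson, *OAQSM 2* (1997), Def. 5.3.18 / Prop. 5.3.19, §6.2.4.
  [cite: BratteliRobinsonII1997, §6.2.4]
-/

noncomputable section

namespace Literature.MathematicalPhysics.QuantumLattice

open _root_.Matrix Finset HubbardWave0 Literature.Probability.LatticeModels _root_.Filter ThermodynamicLimit
open Literature.MathematicalPhysics.QuantumManyBody.StateRelaxation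
open scoped _root_.Topology ComplexOrder

/-! ### §1. Density and mean energy of a torus limit from the global number / energy expectations -/

section Dictionary

variable {d : ℕ} {ω : InfVolFermionState d} {ψ : ∀ L, Fock (Orb (FermionTorus d L))} {Ls : ℕ → ℕ}

/-- **The density of a torus limit is the limit of the number densities** `Σ_σ Re⟨ψ, N_σ ψ⟩ / L^d` of
the (arbitrary, not necessarily fixed-particle-number) vectors `ψ_{L_j}` (the translates of `n_{0σ}` sum
to `N_σ`, `torusAvgExpect_nAt`). [cite: BratteliRobinsonII1997, §6.2.4] -/
theorem InfVolFermionState.IsTorusLimitOf.density_eq_of_tendsto_number (h : ω.IsTorusLimitOf ψ Ls)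
    (hLs : Tendsto Ls atTop atTop) {ρ : ℝ}
    (hN : Tendsto (fun j => (∑ σ : Fin 2,
        (star (ψ (Ls j)) ⬝ᵥ ((∑ y : FermionTorus d (Ls j), numberOp y σ) *ᵥ ψ (Ls j))).re) / ((Ls j : ℝ)) ^ d)
      atTop (𝓝 ρ)) :
    ω.density = ρ := by
  have h0 := h ({0} : Finset (Site d)) (nAt 0 (Finset.mem_singleton_self 0) 0)
  have h1 := h ({0} : Finset (Site d)) (nAt 0 (Finset.mem_singleton_self 0) 1)
  have hsum := (Complex.continuous_re.tendsto _).comp (h0.add h1)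
  have heq : ∀ᶠ j in atTop,
      ((fun z : ℂ => z.re) ∘ fun j =>
          torusAvgExpect (Ls j) ({0} : Finset (Site d)) (nAt 0 (Finset.mem_singleton_self 0) 0) (ψ (Ls j)) +
            torusAvgExpect (Ls j) ({0} : Finset (Site d)) (nAt 0 (Finset.mem_singleton_self 0) 1) (ψ (Ls j))) j =
        (∑ σ : Fin 2, (star (ψ (Ls j)) ⬝ᵥ ((∑ y : FermionTorus d (Ls j), numberOp y σ) *ᵥ ψ (Ls j))).re) /
          ((Ls j : ℝ)) ^ d := by
    filter_upwards [hLs.eventually_ge_atTop 1] with j hj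
    haveI : NeZero (Ls j) := ⟨Nat.one_le_iff_ne_zero.1 hj⟩
    rw [Function.comp_apply, torusAvgExpect_nAt, torusAvgExpect_nAt, Fin.sum_univ_two, Complex.add_re,
      ← Complex.ofReal_natCast, ← Complex.ofReal_pow, Complex.div_ofReal_re, Complex.div_ofReal_re, add_div]
    rfl
  have hlim : Tendsto (fun j => (∑ σ : Fin 2,
      (star (ψ (Ls j)) ⬝ᵥ ((∑ y : FermionTorus d (Ls j), numberOp y σ) *ᵥ ψ (Ls j))).re) / ((Ls j : ℝ)) ^ d) atTop
      (𝓝 ((ω.expect {0} (nAt 0 (Finset.mem_singleton_self 0) 0) +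
        ω.expect {0} (nAt 0 (Finset.mem_singleton_self 0) 1)).re)) :=
    hsum.congr' heq
  have hval := tendsto_nhds_unique hlim hN
  rw [InfVolFermionState.density, InfVolFermionState.densityAt, map_add, hval]

end Dictionary

section TTPrime

variable {ω : InfVolFermionState 2} {ψ : ∀ L, Fock (Orb (FermionTorus 2 L))} {Ls : ℕ → ℕ}

/-- **The `t–t'` mean energy of a torus limit is the limit of the energies per site** `Re⟨ψ, H^{tt'}_L ψ⟩/L²`
of the vectors `ψ_{L_j}` — for ARBITRARY vectors (the translates of the mean-energy observable sum to the torus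
Hamiltonian, `torusAvgExpect_hubbardTTPrime_meanEnergyObs`). [cite: BratteliKishimotoRobinson1978, §3 (mean energy functional)] -/
theorem InfVolFermionState.IsTorusLimitOf.tendsto_energyPerSite_hubbardTTPrime (t t' U : ℝ) (h : ω.IsTorusLimitOf ψ Ls)
    (hLs : Tendsto Ls atTop atTop) :
    Tendsto (fun j => (star (ψ (Ls j)) ⬝ᵥ (hubbardTorusTT' (Ls j) t t' U *ᵥ ψ (Ls j))).re / (Ls j : ℝ) ^ 2)
      atTop (𝓝 (ω.meanEnergy (hubbardTTPrimeFermionInteraction t t' U) 1)) := by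
  have hlim := (Complex.continuous_re.tendsto _).comp
    (h (thicken ({0} : Finset (Site 2)) 1) ((hubbardTTPrimeFermionInteraction t t' U).meanEnergyObs 1))
  refine hlim.congr' ?_
  filter_upwards [hLs.eventually_ge_atTop 3] with j hj
  rw [Function.comp_apply, torusAvgExpect_hubbardTTPrime_meanEnergyObs t t' U hj, ← Complex.ofReal_natCast,
    ← Complex.ofReal_pow, Complex.div_ofReal_re]
  rfl

/-- **An asymptotic energy cap per site is a cap on the mean energy of every torus limit**: if for every
`ε > 0` eventually `Re⟨ψ, H^{tt'}_L ψ⟩/L² ≤ e + ε`, then `e_ω ≤ e`. [cite: BratteliKishimotoRobinson1978, §3] -/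
theorem InfVolFermionState.IsTorusLimitOf.meanEnergy_hubbardTTPrime_le_of_eventually_le (t t' U : ℝ) (h : ω.IsTorusLimitOf ψ Ls)
    (hLs : Tendsto Ls atTop atTop) {e : ℝ}
    (hE : ∀ ε : ℝ, 0 < ε → ∀ᶠ j in atTop,
      (star (ψ (Ls j)) ⬝ᵥ (hubbardTorusTT' (Ls j) t t' U *ᵥ ψ (Ls j))).re / (Ls j : ℝ) ^ 2 ≤ e + ε) :
    ω.meanEnergy (hubbardTTPrimeFermionInteraction t t' U) 1 ≤ e := by
  refine le_of_forall_pos_le_add fun ε hε => ?_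
  exact le_of_tendsto (h.tendsto_energyPerSite_hubbardTTPrime t t' U hLs) (hE ε hε)

/-! ### §2. Torus limits of asymptotically ground-state families are canonical-class minimisers -/

/-- **Torus limits of ASYMPTOTICALLY ground-state families are fixed-density minimisers.** `U ≥ 0`,
`0 < n < 2`. Let `ψ_{L_j}` be ANY vectors of the `L_j × L_j` tori, `L_j → ∞`, whose number densities
`Σ_σ Re⟨ψ, N_σ ψ⟩/L_j²` tend to `n` and whose energies per site are asymptotically at most the ground-state
energy density, `∀ ε > 0`, eventually `Re⟨ψ, H^{tt'}_{L_j} ψ⟩/L_j² ≤ e(t,t',U,n) + ε`. Then every torus limit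
`ω` is translation invariant, has density `n`, has mean energy EXACTLY `e(t,t',U,n)`, and minimises the
`t–t'` mean energy among translation-invariant states of density `n`. (Exact sector ground states are the
special case `Re⟨ψ, Hψ⟩ = E₀(rectN n L)`; the Koma–Tasaki / KHvdL one-point witnesses and the charge towers of
a sector ground state are the intended non-trivial case.) [cite: KomaTasaki1994, §2.2] [cite: BratteliKishimotoRobinson1978, Thm. 2 (p. 47)] -/
theorem InfVolFermionState.IsTorusLimitOf.canonicalMinimiser_of_asymptoticGroundStates (t t' : ℝ) {U n : ℝ} (hU : 0 ≤ U)
    (hn0 : 0 < n) (hn2 : n < 2) (h : ω.IsTorusLimitOf ψ Ls) (hLs : Tendsto Ls atTop atTop)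
    (hN : Tendsto (fun j => (∑ σ : Fin 2,
        (star (ψ (Ls j)) ⬝ᵥ ((∑ y : FermionTorus 2 (Ls j), numberOp y σ) *ᵥ ψ (Ls j))).re) / ((Ls j : ℝ)) ^ 2)
      atTop (𝓝 n))
    (hE : ∀ ε : ℝ, 0 < ε → ∀ᶠ j in atTop,
      (star (ψ (Ls j)) ⬝ᵥ (hubbardTorusTT' (Ls j) t t' U *ᵥ ψ (Ls j))).re / (Ls j : ℝ) ^ 2 ≤
        energyDensityTT' t t' U n + ε) :
    ω.IsTranslationInvariant ∧ ω.density = n ∧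
      ω.meanEnergy (hubbardTTPrimeFermionInteraction t t' U) 1 = energyDensityTT' t t' U n ∧
      ∀ σ : InfVolFermionState 2, σ.IsTranslationInvariant → σ.density = n →
        ω.meanEnergy (hubbardTTPrimeFermionInteraction t t' U) 1 ≤
          σ.meanEnergy (hubbardTTPrimeFermionInteraction t t' U) 1 := by
  have hTI := h.isTranslationInvariant
  have hρ := h.density_eq_of_tendsto_number hLs hN
  have hle := h.meanEnergy_hubbardTTPrime_le_of_eventually_le t t' U hLs hE
  have hge := energyDensityTT'_le_meanEnergy_of_isTranslationInvariant t t' hU hn0 hn2 hTI hρ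
  refine ⟨hTI, hρ, le_antisymm hle hge, fun σ hσ hσn => ?_⟩
  exact hle.trans (energyDensityTT'_le_meanEnergy_of_isTranslationInvariant t t' hU hn0 hn2 hσ hσn)

/-! ### §3. … hence ground states of `H^{tt'} − μN`: all ground-state rows -/

/-- **Torus limits of asymptotically ground-state families are minimisers and ground states of `H^{tt'} − μN`
for a supporting chemical potential `μ`** (same hypotheses as
`canonicalMinimiser_of_asymptoticGroundStates`). [cite: BratteliKishimotoRobinson1978, Thm. 2 (p. 47)] [cite: Ruelle1969, §3.4] -/
theorem InfVolFermionState.IsTorusLimitOf.exists_groundState_hubbardTTPrimeMu_of_asymptoticGroundStates (t t' : ℝ) {U n : ℝ}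
    (hU : 0 ≤ U) (hn0 : 0 < n) (hn2 : n < 2) (h : ω.IsTorusLimitOf ψ Ls) (hLs : Tendsto Ls atTop atTop)
    (hN : Tendsto (fun j => (∑ σ : Fin 2,
        (star (ψ (Ls j)) ⬝ᵥ ((∑ y : FermionTorus 2 (Ls j), numberOp y σ) *ᵥ ψ (Ls j))).re) / ((Ls j : ℝ)) ^ 2)
      atTop (𝓝 n))
    (hE : ∀ ε : ℝ, 0 < ε → ∀ᶠ j in atTop,
      (star (ψ (Ls j)) ⬝ᵥ (hubbardTorusTT' (Ls j) t t' U *ᵥ ψ (Ls j))).re / (Ls j : ℝ) ^ 2 ≤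
        energyDensityTT' t t' U n + ε) :
    ∃ μ : ℝ, ω.IsMeanEnergyMinimiser (hubbardTTPrimeMuInteraction t t' U μ) 1 ∧
      ω.IsGroundState (hubbardTTPrimeMuInteraction t t' U μ) 1 := by
  obtain ⟨hTI, hρ, -, hmin⟩ := h.canonicalMinimiser_of_asymptoticGroundStates t t' hU hn0 hn2 hLs hN hE
  exact InfVolFermionState.exists_isGroundState_hubbardTTPrimeMu_of_canonicalMinimiser hTI hρ hn0 hn2 hmin

/-- A Bratteli–Robinson ground state in `ComplexOrder` form: `0 ≤ ω((ΓA)⋆[H_{Λ_R}, ΓA])` (real and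
nonnegative) for every local `A`. [cite: BratteliRobinsonII1997, Def. 5.3.18] -/
theorem InfVolFermionState.IsGroundState.expect_conj_commutator_nonneg' {d : ℕ} {ω : InfVolFermionState d} {Ψ : FermionInteraction d}
    {R : ℝ} (hgs : ω.IsGroundState Ψ R) (Λ : Finset (Site d)) (A : FermionOp Λ) :
    0 ≤ ω.expect (thicken Λ R) ((fermionEmbed (PolySite.incl (subset_thicken Λ R)) A)ᴴ *
      (Ψ.localHamiltonian (thicken Λ R) * fermionEmbed (PolySite.incl (subset_thicken Λ R)) A -
        fermionEmbed (PolySite.incl (subset_thicken Λ R)) A * Ψ.localHamiltonian (thicken Λ R))) := by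
  have h := hgs Λ A
  rwa [FermionInteraction.derivation, Matrix.mul_smul, map_smul, smul_eq_mul, ← mul_assoc,
    show -Complex.I * Complex.I = 1 by rw [neg_mul, Complex.I_mul_I, neg_neg], one_mul] at h

/-- **All ground-state rows of a torus limit of an asymptotically ground-state family, with ONE chemical
potential.** For some `μ` — the one for which `ω` is a minimiser and a ground state of `H^{tt'} − μN` — EVERY
local `A ∈ 𝔄_Λ` (arbitrary particle charge and spin: pair and Nambu generators included) satisfies the
Bratteli–Robinson inequality `Re ω((ΓA)⋆[H^{tt'μ}_{Λ₁}, ΓA]) ≥ 0` and stationarity `ω([H^{tt'μ}_{Λ₁}, ΓA]) = 0`,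
`H^{tt'μ}_{Λ₁} = (hubbardTTPrimeMuInteraction t t' U μ).localHamiltonian (thicken Λ 1)`.
[cite: BratteliKishimotoRobinson1978, Thm. 2 (p. 47)] [cite: KomaTasaki1994, §2.2] -/
theorem InfVolFermionState.IsTorusLimitOf.groundStateRows_of_asymptoticGroundStates (t t' : ℝ) {U n : ℝ}
    (hU : 0 ≤ U) (hn0 : 0 < n) (hn2 : n < 2) (h : ω.IsTorusLimitOf ψ Ls) (hLs : Tendsto Ls atTop atTop)
    (hN : Tendsto (fun j => (∑ σ : Fin 2,
        (star (ψ (Ls j)) ⬝ᵥ ((∑ y : FermionTorus 2 (Ls j), numberOp y σ) *ᵥ ψ (Ls j))).re) / ((Ls j : ℝ)) ^ 2)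
      atTop (𝓝 n))
    (hE : ∀ ε : ℝ, 0 < ε → ∀ᶠ j in atTop,
      (star (ψ (Ls j)) ⬝ᵥ (hubbardTorusTT' (Ls j) t t' U *ᵥ ψ (Ls j))).re / (Ls j : ℝ) ^ 2 ≤
        energyDensityTT' t t' U n + ε) :
    ∃ μ : ℝ, ω.IsMeanEnergyMinimiser (hubbardTTPrimeMuInteraction t t' U μ) 1 ∧
      ω.IsGroundState (hubbardTTPrimeMuInteraction t t' U μ) 1 ∧
      ∀ (Λ : Finset (Site 2)) (A : FermionOp Λ),
        0 ≤ ω.expect (thicken Λ 1) ((fermionEmbed (PolySite.incl (subset_thicken Λ 1)) A)ᴴ *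
          ((hubbardTTPrimeMuInteraction t t' U μ).localHamiltonian (thicken Λ 1) *
              fermionEmbed (PolySite.incl (subset_thicken Λ 1)) A -
            fermionEmbed (PolySite.incl (subset_thicken Λ 1)) A *
              (hubbardTTPrimeMuInteraction t t' U μ).localHamiltonian (thicken Λ 1))) ∧
        ω.expect (thicken Λ 1)
          ((hubbardTTPrimeMuInteraction t t' U μ).localHamiltonian (thicken Λ 1) *
              fermionEmbed (PolySite.incl (subset_thicken Λ 1)) A -
            fermionEmbed (PolySite.incl (subset_thicken Λ 1)) A *
              (hubbardTTPrimeMuInteraction t t' U μ).localHamiltonian (thicken Λ 1)) = 0 := by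
  obtain ⟨μ, hmin, hgs⟩ := h.exists_groundState_hubbardTTPrimeMu_of_asymptoticGroundStates t t' hU hn0 hn2 hLs hN hE
  exact ⟨μ, hmin, hgs, fun Λ A =>
    ⟨hgs.expect_conj_commutator_nonneg' Λ A, hgs.expect_commutator_localHamiltonian_eq_zero Λ A⟩⟩

/-- **Every PSD-weighted KKT block of `H^{tt'} − μN` is nonnegative in a ground state of the pencil, for
ARBITRARY local generators** (no conservation hypothesis: charged / Nambu / spin-flip generators allowed):
`G ⪰ 0` ⇒ `0 ≤ Re ω(kktForm H^{tt'μ}_{Λ₁} G B̃)`, `B̃_b = Γ(incl) B_b`. Weak duality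
(`re_map_kktForm_nonneg`) on the Bratteli–Robinson inequality. [cite: BratteliRobinsonII1997, Def. 5.3.18] [cite: AraujoEtAl2023, §3.2 Prop. 11] -/
theorem InfVolFermionState.IsGroundState.re_expect_kktForm_nonneg {Ψ : FermionInteraction 2} {R : ℝ} (hgs : ω.IsGroundState Ψ R)
    {Λ : Finset (Site 2)} {m : Type*} [Fintype m] [DecidableEq m] {G : Matrix m m ℂ} (hG : G.PosSemidef)
    (B : m → FermionOp Λ) :
    0 ≤ (ω.expect (thicken Λ R)
      (kktForm (Ψ.localHamiltonian (thicken Λ R)) G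
        (fun b => fermionEmbed (PolySite.incl (subset_thicken Λ R)) (B b)))).re := by
  refine re_map_kktForm_nonneg (ω.expect (thicken Λ R)) _ hG _ fun w => ?_
  have hsum : ∑ b, w b • fermionEmbed (PolySite.incl (subset_thicken Λ R)) (B b) =
      fermionEmbed (PolySite.incl (subset_thicken Λ R)) (∑ b, w b • B b) := by
    rw [map_sum]
    exact Finset.sum_congr rfl fun b _ => (map_smul _ _ _).symm
  rw [hsum, Matrix.star_eq_conjTranspose]
  exact (Complex.nonneg_iff.1 (hgs.expect_conj_commutator_nonneg' Λ _)).1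

/-- The same in `ComplexOrder`. [cite: BratteliRobinsonII1997, Def. 5.3.18] [cite: AraujoEtAl2023, §3.2 Prop. 11] -/
theorem InfVolFermionState.IsGroundState.expect_kktForm_nonneg {Ψ : FermionInteraction 2} {R : ℝ} (hgs : ω.IsGroundState Ψ R)
    {Λ : Finset (Site 2)} {m : Type*} [Fintype m] [DecidableEq m] {G : Matrix m m ℂ} (hG : G.PosSemidef)
    (B : m → FermionOp Λ) :
    0 ≤ ω.expect (thicken Λ R)
      (kktForm (Ψ.localHamiltonian (thicken Λ R)) G
        (fun b => fermionEmbed (PolySite.incl (subset_thicken Λ R)) (B b))) := by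
  refine map_kktForm_nonneg (ω.expect (thicken Λ R)) _ hG _ fun w => ?_
  have hsum : ∑ b, w b • fermionEmbed (PolySite.incl (subset_thicken Λ R)) (B b) =
      fermionEmbed (PolySite.incl (subset_thicken Λ R)) (∑ b, w b • B b) := by
    rw [map_sum]
    exact Finset.sum_congr rfl fun b _ => (map_smul _ _ _).symm
  rw [hsum, Matrix.star_eq_conjTranspose]
  exact hgs.expect_conj_commutator_nonneg' Λ _

/-- **KKT blocks of the pencil in torus limits of asymptotically ground-state families**: for some `μ` (the
supporting chemical potential, for which `ω` is a minimiser of `H^{tt'} − μN`), every PSD-weighted KKT block of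
`H^{tt'μ}_{Λ₁}` over ARBITRARY local generators is nonnegative — the licence for `kkt` / Nambu rows of the
common-`μ` one-point program on the objects read through Koma–Tasaki witnesses.
[cite: KomaTasaki1994, §2.2] [cite: AraujoEtAl2023, §3.2 Prop. 11] -/
theorem InfVolFermionState.IsTorusLimitOf.exists_re_expect_kktForm_pencil_nonneg_of_asymptoticGroundStates (t t' : ℝ) {U n : ℝ}
    (hU : 0 ≤ U) (hn0 : 0 < n) (hn2 : n < 2) (h : ω.IsTorusLimitOf ψ Ls) (hLs : Tendsto Ls atTop atTop)
    (hN : Tendsto (fun j => (∑ σ : Fin 2,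
        (star (ψ (Ls j)) ⬝ᵥ ((∑ y : FermionTorus 2 (Ls j), numberOp y σ) *ᵥ ψ (Ls j))).re) / ((Ls j : ℝ)) ^ 2)
      atTop (𝓝 n))
    (hE : ∀ ε : ℝ, 0 < ε → ∀ᶠ j in atTop,
      (star (ψ (Ls j)) ⬝ᵥ (hubbardTorusTT' (Ls j) t t' U *ᵥ ψ (Ls j))).re / (Ls j : ℝ) ^ 2 ≤
        energyDensityTT' t t' U n + ε) :
    ∃ μ : ℝ, ω.IsMeanEnergyMinimiser (hubbardTTPrimeMuInteraction t t' U μ) 1 ∧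
      ∀ (Λ : Finset (Site 2)) {m : Type} [Fintype m] [DecidableEq m] {G : Matrix m m ℂ}, G.PosSemidef →
        ∀ B : m → FermionOp Λ,
          0 ≤ (ω.expect (thicken Λ 1)
            (kktForm ((hubbardTTPrimeMuInteraction t t' U μ).localHamiltonian (thicken Λ 1)) G
              (fun b => fermionEmbed (PolySite.incl (subset_thicken Λ 1)) (B b)))).re := by
  obtain ⟨μ, hmin, hgs⟩ := h.exists_groundState_hubbardTTPrimeMu_of_asymptoticGroundStates t t' hU hn0 hn2 hLs hN hE
  exact ⟨μ, hmin, fun Λ m _ _ G hG B => hgs.re_expect_kktForm_nonneg hG B⟩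

/-- **The `μ`-free rows**: in a torus limit of an asymptotically ground-state family, every local `A` commuting
with the local particle number `N_{Λ₁}` obeys `Re ω((ΓA)⋆[H^{tt'}_{Λ₁}, ΓA]) ≥ 0` and `ω([H^{tt'}_{Λ₁}, ΓA]) = 0`
(no chemical potential to know; spin-flipping `A` allowed). [cite: BratteliKishimotoRobinson1978, Thm. 2 (p. 47)] -/
theorem InfVolFermionState.IsTorusLimitOf.kkt_of_commute_number_of_asymptoticGroundStates (t t' : ℝ) {U n : ℝ}
    (hU : 0 ≤ U) (hn0 : 0 < n) (hn2 : n < 2) (h : ω.IsTorusLimitOf ψ Ls) (hLs : Tendsto Ls atTop atTop)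
    (hN : Tendsto (fun j => (∑ σ : Fin 2,
        (star (ψ (Ls j)) ⬝ᵥ ((∑ y : FermionTorus 2 (Ls j), numberOp y σ) *ᵥ ψ (Ls j))).re) / ((Ls j : ℝ)) ^ 2)
      atTop (𝓝 n))
    (hE : ∀ ε : ℝ, 0 < ε → ∀ᶠ j in atTop,
      (star (ψ (Ls j)) ⬝ᵥ (hubbardTorusTT' (Ls j) t t' U *ᵥ ψ (Ls j))).re / (Ls j : ℝ) ^ 2 ≤
        energyDensityTT' t t' U n + ε)
    (Λ : Finset (Site 2)) (A : FermionOp Λ)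
    (hA : Commute ((numberInteraction 2).localHamiltonian (thicken Λ 1))
      (fermionEmbed (PolySite.incl (subset_thicken Λ 1)) A)) :
    0 ≤ (ω.expect (thicken Λ 1) ((fermionEmbed (PolySite.incl (subset_thicken Λ 1)) A)ᴴ *
        ((hubbardTTPrimeFermionInteraction t t' U).localHamiltonian (thicken Λ 1) *
            fermionEmbed (PolySite.incl (subset_thicken Λ 1)) A -
          fermionEmbed (PolySite.incl (subset_thicken Λ 1)) A *
            (hubbardTTPrimeFermionInteraction t t' U).localHamiltonian (thicken Λ 1)))).re ∧
      ω.expect (thicken Λ 1)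
        ((hubbardTTPrimeFermionInteraction t t' U).localHamiltonian (thicken Λ 1) *
            fermionEmbed (PolySite.incl (subset_thicken Λ 1)) A -
          fermionEmbed (PolySite.incl (subset_thicken Λ 1)) A *
            (hubbardTTPrimeFermionInteraction t t' U).localHamiltonian (thicken Λ 1)) = 0 := by
  obtain ⟨hTI, hρ, -, hmin⟩ := h.canonicalMinimiser_of_asymptoticGroundStates t t' hU hn0 hn2 hLs hN hE
  exact InfVolFermionState.canonicalMinimiser_ttPrime_kkt_of_commute_number hTI hρ hn0 hn2 hmin Λ A hA

end TTPrime

/-! ### §4. (appended 2026-08-27) The supporting chemical potential lies in the subdifferential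
`[μ₋(n), μ₊(n)]` of the ground-state energy density — the bracket the one-point certificates cover -/

section Bracket

variable {ω : InfVolFermionState 2}

/-- **The supporting `μ` of a density-`n` minimiser is a subgradient of `e(t,t',U,·)` at `n`**: if `ω` is a
mean-energy minimiser of `H^{tt'} − μN` with density `n ∈ (0,2)` and mean energy `e(t,t',U,n)` (`U ≥ 0`), then
`n` minimises `x ↦ e(x) − μx` on `[0,2)` (every `e(x)` is the `t–t'` mean energy of a translation-invariant state
of density `x`, `exists_isTorusLimitOf_squareGroundStatesTT'_meanEnergy_eq`), hence
`μ₋(n) ≤ μ ≤ μ₊(n)` (`chemPotMinusTT' / chemPotPlusTT'`, the one-sided derivatives).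
[cite: Ruelle1969, §3.4] [cite: BratteliKishimotoRobinson1978, Thm. 2 (p. 47)] -/
theorem InfVolFermionState.IsMeanEnergyMinimiser.chemPot_mem_Icc_of_density (t t' : ℝ) {U n μ : ℝ}
    (hU : 0 ≤ U) (hn0 : 0 < n) (hn2 : n < 2)
    (hmin : ω.IsMeanEnergyMinimiser (hubbardTTPrimeMuInteraction t t' U μ) 1) (hρ : ω.density = n)
    (hme : ω.meanEnergy (hubbardTTPrimeFermionInteraction t t' U) 1 = energyDensityTT' t t' U n) :
    μ ∈ Set.Icc (chemPotMinusTT' t t' U n) (chemPotPlusTT' t t' U n) := by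
  have hIsMin : IsMinOn (fun x => energyDensityTT' t t' U x - μ * x) (Set.Ico (0 : ℝ) 2) n := by
    intro x hx
    obtain ⟨ψx, Lsx, σ, -, -, hσTI, -, -, -, hσρ, -, hσe⟩ :=
      exists_isTorusLimitOf_squareGroundStatesTT'_meanEnergy_eq (t := t) (t' := t') hU hx.1 hx.2
    have h := hmin.2 σ hσTI
    rw [InfVolFermionState.meanEnergy_hubbardTTPrimeMu, InfVolFermionState.meanEnergy_hubbardTTPrimeMu, hρ, hme,
      hσρ, hσe] at h
    simpa only [Set.mem_setOf_eq] using h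
  exact ⟨chemPotMinusTT'_le_of_isMinOn t t' hU hn0 hn2 hIsMin, le_chemPotPlusTT'_of_isMinOn t t' hU hn0 hn2 hIsMin⟩

variable {ψ : ∀ L, Fock (Orb (FermionTorus 2 L))} {Ls : ℕ → ℕ}

/-- **Torus limits of asymptotically ground-state families: minimiser and ground state of `H^{tt'} − μN` for a
`μ` IN THE SUBDIFFERENTIAL `[μ₋(n), μ₊(n)]`** — the form consumed by the common-`μ` one-point program (a
certified bracket `[hlo, hhi] ⊇ [μ₋(n), μ₊(n)]` is covered by cells). Same hypotheses as
`canonicalMinimiser_of_asymptoticGroundStates`. [cite: Ruelle1969, §3.4] [cite: KomaTasaki1994, §2.2] -/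
theorem InfVolFermionState.IsTorusLimitOf.exists_groundState_hubbardTTPrimeMu_mem_Icc_of_asymptoticGroundStates
    (t t' : ℝ) {U n : ℝ} (hU : 0 ≤ U) (hn0 : 0 < n) (hn2 : n < 2) (h : ω.IsTorusLimitOf ψ Ls)
    (hLs : Tendsto Ls atTop atTop)
    (hN : Tendsto (fun j => (∑ σ : Fin 2,
        (star (ψ (Ls j)) ⬝ᵥ ((∑ y : FermionTorus 2 (Ls j), numberOp y σ) *ᵥ ψ (Ls j))).re) / ((Ls j : ℝ)) ^ 2)
      atTop (𝓝 n))
    (hE : ∀ ε : ℝ, 0 < ε → ∀ᶠ j in atTop,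
      (star (ψ (Ls j)) ⬝ᵥ (hubbardTorusTT' (Ls j) t t' U *ᵥ ψ (Ls j))).re / (Ls j : ℝ) ^ 2 ≤
        energyDensityTT' t t' U n + ε) :
    ∃ μ ∈ Set.Icc (chemPotMinusTT' t t' U n) (chemPotPlusTT' t t' U n),
      ω.IsMeanEnergyMinimiser (hubbardTTPrimeMuInteraction t t' U μ) 1 ∧
      ω.IsGroundState (hubbardTTPrimeMuInteraction t t' U μ) 1 := by
  obtain ⟨-, hρ, hme, -⟩ := h.canonicalMinimiser_of_asymptoticGroundStates t t' hU hn0 hn2 hLs hN hE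
  obtain ⟨μ, hmin, hgs⟩ := h.exists_groundState_hubbardTTPrimeMu_of_asymptoticGroundStates t t' hU hn0 hn2 hLs hN hE
  exact ⟨μ, hmin.chemPot_mem_Icc_of_density t t' hU hn0 hn2 hρ hme, hmin, hgs⟩

end Bracket

end Literature.MathematicalPhysics.QuantumLattice

end
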